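import Literature.MathematicalPhysics.QuantumFieldTheory.BalabanImbrieJaffe1984to88.BIJ88Ineq5144Located
import Literature.MathematicalPhysics.QuantumFieldTheory.BalabanImbrieJaffe1984to88.BIJ88GaussShellModulus309

/-!
# `BalabanImbrieJaffe1984to88.BIJ88SlotConnectedGraph310KPLoc` — T. Bałaban, J. Imbrie, A. Jaffe, *Effective action and cluster properties of the
abelian Higgs model*, Commun. Math. Phys. **114** (1988) 257–315 [BalabanImbrieJaffe1988], Sect. 5.14 pp. 308–310 [PDF 52–54]: **THE MODEL THEOREMS
"MODULO THE LEAF (5.14.4)" RE-DERIVED FROM THE LEAF IN THE LOCATED READING** (p. 309: *"Here H_β ⊂ H specifies which (d/dt)_{γ_j} have supports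
intersecting X_β"*) — the located twins, with VERBATIM conclusions, of this seat's gen 11 `BIJ88SlotConnectedGraph310KP` (the *"standard exercise"*
for the slot data of an assignment: `hT`, the bound on the truncated functions, zero-freeness of the normalization, display 2 with the display-3
truncations, `Σ_γ T_γ(K) = (d/dt)^{|K|} log z_t`, the (5.14.2) remainder and its `O(|W|)` bound), of gen 11 `BIJ88SlotCumulants308.ursell_slotMoment_fieldLaw_eq_Tsum_of_ineq5144`
(cumulants = connected-graph series) and of gen 12 `BIJ88GaussShellModulus309` (`…_Tsum_of_ineq5144_mod`, `abs_effectiveAction_sub_pertP_le_of_ineq5144_mod`: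
(5.14.1)–(5.14.2) at `t = 0` with the remainder as the display-3 series, linear-or-modulus slot fields, no centring).

statement-level skeleton of published theorems with citation tags; proofs where landed; nothing here is a claim about the Yang–Mills mass gap

WHY (GAPS G-C2-p36-07, sibling `BIJ88Ineq5144Located`): the landed originals take the leaf (5.14.4) in the UNLOCATED instantiation
`Ineq5144 (cubeSys I) (Finset L) (prime (g3 adj (H' ↦ zG … γ H'))) card (H X ↦ |X ∖ (cube∘γ) H|) θ β′`, which is unsatisfiable for the (slot-local)
Gaussian data with `θ < 1` (`BIJ88Ineq5144Located.not_ineq5144_unlocated`): they are vacuous as stated.  Here every `h5144` is THE LEAF BY NAME ON THE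
LOCATED ACTIVITY, `Ineq5144 (cubeSys I) (Finset L) (locAct (cube ∘ γ) (prime (g3 adj (H' ↦ zG … γ H')))) card (…) θ β′` — the support-conditioned
(5.14.4) of the print (`ineq5144_locAct_iff`) — and the proofs are the landed ones with the leaf lemmas replaced by their located twins
(`summable_norm_Tord_vsupp_of_ineq5144_loc`, `abs_Tsum_vsupp_le_of_ineq5144_loc`, `corner_empty_ne_zero_of_ineq5144_loc`).  Each twin implies its landed
original (`ineq5144_locAct_of_unlocated`).  PDF held: `paper:balaban1988-cmp114-bij-abelian-higgs-effective-action` (journal page = PDF page + 256).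

HONEST SCOPE: (5.14.4) NOT proved (typed leaf, located reading); finite-dimensional real Gaussian model of §5.13 (gens 8–13); slip G-C2-p36-06;
gen 5's regime.  0 `sorry`, 0 definitions, 0 `Prop` facts (D-0026); imports `BIJ88Ineq5144Located` (p36 g14), `BIJ88GaussShellModulus309` (p36 g12).
NOT summit progress; NOT continuum; NOT Clay.  Cell `lit-balaban` Phase 2, seat p36 gen 14 (rows C2.Eq5.14.1-5.14.2 / 5.14.3-5.14.4 / Claim@310, owner r16).
-/

noncomputable section

namespace Literature.MathematicalPhysics.QuantumFieldTheory.BalabanImbrieJaffe1984to88.BIJ88SlotConnectedGraph310KPLoc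

open Finset MeasureTheory ProbabilityTheory Filter
open scoped Topology
open Literature.Probability.LatticeModels (setPartitions ursellOf)
open Literature.MathematicalPhysics.QuantumFieldTheory.BalabanImbrieJaffe1984to88.BIJ88TruncatedExpectation5142 (asg)
open BIJ88Clusters5134 (IsClusterFactorizing)
open BIJ88PolymerRep5134 (corner)
open BIJ88PolymerRep5134Gauss (ext prec zG isClusterFactorizing_zG)
open BIJ88Expansion5143 (g3 prime IsSlotLocal)
open BIJ88Expansion5143Gauss (fD fD_local fD_slot isSlotLocal_zG)
open BIJ88Expansion5143Ordered (polysOf cvsupp locv wv)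
open BIJ88ConnectedGraphResummation (Tsum Tord)
open BIJ88SlotMoments308 (zt slotMoment succ_mul_remR)
open BIJ88SlotMomentsGauss308 (fieldLaw uD)
open BIJ88SlotConnectedGraph310 (uD_local zG_fD_div_eq_sum_setPartitions_Tsum sum_asg_Tsum_eq_iteratedDeriv_log_zG
  sum_Tsum_univ_eq_iteratedDeriv_log_zG remR_sum_Tsum_eq_integral_log_zG trunc_eq_Tsum_of_display2)
open BIJ88SlotCumulants308 (slotMoment_eq_sum_setPartitions_ursell)
open BIJ88Expansion5143KP (isKPVolume_vacuum_of_norm5144 isClusterFactorizing_cpx isSlotLocal_cpx norm_prime_g3_cpx)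
open BIJ88Expansion5143Obs (corner_empty_ne_zero)
open BIJ88RemainderW6Tsum (kp_smallness_of_regime)
open BIJ88EffectiveActionGauss308 (remR_congr_Ioc)
open BIJ88GaussShellModulus309 (effectiveAction_fieldLaw_eq_pertP_add_remR_ursell_mod)
open BIJ88Ineq5113Covering (cubeSys)
open BIJ88Sect5Statements (CutoffProfile)
open BIJ88Sect5StatementsPart2 (Ineq5144)
open BIJ88Sect5StatementsPart4 (remR pertP)
open BIJ88Ineq5144Located (locAct locAct_empty summable_norm_Tord_vsupp_of_ineq5144_loc abs_Tsum_vsupp_le_of_ineq5144_loc)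

/-! ## §0 The normalization does not vanish, from the located leaf (p25's KP zero-freeness needs `H_β = ∅` only) -/
section Corner

variable {ι : Type} [DecidableEq ι] [Fintype ι] {S : Type} [DecidableEq S] [Fintype S] {adj : ι → ι → Prop} [DecidableRel adj]
  {nbr : ι → Finset ι} {Δ : ℕ} {W : Finset ι} {loc : S → ι} {zr : Finset S → Finset ι → Finset ι → ℝ} {θ β' : ℝ}

omit [Fintype ι] [Fintype S] in
/-- **THE NORMALIZATION DOES NOT VANISH, FROM THE LOCATED LEAF** (p. 310: *"This enables us to factor out the normalization"*): p25's
`BIJ88Expansion5143KP.corner_empty_ne_zero_of_ineq5144` needs (5.14.4) at `H_β = ∅` only — a located pair — so the located leaf suffices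
(`isKPVolume_vacuum_of_norm5144`, `corner_empty_ne_zero`). [cite: BalabanImbrieJaffe1988, (5.14.4) p.309, p.310 (Sect. 5.14)] -/
theorem corner_empty_ne_zero_of_ineq5144_loc (hR : ∀ x y, adj x y → adj y x) (hΔ : ∀ x, (nbr x).card ≤ Δ)
    (hnbr : ∀ x y, adj x y → y ∈ nbr x) (hθ : 0 ≤ θ) (hsmall : 2 * Real.exp 1 * θ ^ β' * ((Δ : ℝ) + 1) ^ 2 ≤ 1)
    (hz0 : IsClusterFactorizing adj (zr ∅)) (hloc : IsSlotLocal loc zr)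
    (h : Ineq5144 (cubeSys ι) (Finset S) (locAct loc (prime (g3 adj zr))) Finset.card (fun H (X : Finset ι) => (X \ H.image loc).card) θ β') :
    zr ∅ W W ≠ 0 := by
  have h0 : ∀ X ∈ polysOf W, ‖prime (g3 adj fun K X Λ => ((zr K X Λ : ℝ) : ℂ)) ∅ X‖ ≤ θ ^ (β' * (X.card : ℝ)) := fun X _ => by
    rw [norm_prime_g3_cpx]
    have hX := h ∅ X
    simp only [locAct_empty, card_empty, Nat.cast_zero, zero_add, image_empty, sdiff_empty] at hX
    exact hX
  have hne := corner_empty_ne_zero (W := W) (z := fun K X Λ => ((zr K X Λ : ℝ) : ℂ)) (isClusterFactorizing_cpx hz0) (isSlotLocal_cpx hloc)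
    (isKPVolume_vacuum_of_norm5144 hR hΔ hnbr hθ hsmall h0)
  exact_mod_cast hne


end Corner

/-! ## §1 Gen 11's `BIJ88SlotConnectedGraph310KP` from the located leaf -/
section Model

variable {α I : Type} [Fintype α] [DecidableEq α] [Fintype I] [DecidableEq I]
  (blk : α → I) (Δ : Matrix α α ℝ) (ℱ : α → ℝ) (W : Finset I) (adj : I → I → Prop) [DecidableRel adj] {nbr : I → Finset I} {D : ℕ}
variable (χ : CutoffProfile) {ι υ : Type*} [DecidableEq ι] [DecidableEq υ]
variable {p ek : ℝ} {B : Finset ι} {Φ : ι → (α → ℝ) → ℝ} {c : ι → ℝ} {Ys : Finset υ} {V : υ → (α → ℝ) → ℝ}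
variable (cube : ↥B ⊕ ↥Ys → I) {θ β' : ℝ} {L : Type} [Fintype L] [DecidableEq L]

/-- **`hT` FOR THE SLOT DATA OF AN ASSIGNMENT, FROM THE LOCATED LEAF** (located twin of gen 11's `summable_norm_Tord_slot_of_ineq5144`): the
connected series of display 3 of every nonempty block converges absolutely. [cite: BalabanImbrieJaffe1988, (5.14.4) p.309, p.310 (Sect. 5.14)] -/
theorem summable_norm_Tord_slot_of_ineq5144_loc (hR : ∀ x y, adj x y → adj y x) (hD : ∀ x, (nbr x).card ≤ D)
    (hnbr : ∀ x y, adj x y → y ∈ nbr x) (hθ0 : 0 < θ) (hθ1 : θ ≤ 1) (hβ : 0 ≤ β')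
    (hsmall : 16 * ((D : ℝ) + 1) ^ 2 * (θ ^ (β' / 2) * Real.exp 2) ≤ 1) (t : ℝ) (γ : L → ↥B ⊕ ↥Ys)
    (h5144 : Ineq5144 (cubeSys I) (Finset L) (locAct (cube ∘ γ) (prime (g3 adj fun H' => zG blk Δ ℱ (fD (uD χ p ek B Φ c Ys V t) cube γ H'))))
      Finset.card (fun H (X : Finset I) => (X \ H.image (cube ∘ γ)).card) θ β') :
    ∀ b : Finset L, b.Nonempty → Summable fun m => ‖Tord ((polysOf W).image (cvsupp adj W)) (locv (cube ∘ γ))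
      (wv (prime (g3 adj fun H' => zG blk Δ ℱ (fD (uD χ p ek B Φ c Ys V t) cube γ H')))) m b‖ :=
  fun _ hb => summable_norm_Tord_vsupp_of_ineq5144_loc hR hD hnbr hθ0 hθ1 hβ hsmall h5144 hb

/-- **the truncated functions of the slot data are bounded** (located twin): `|T_γ(b)| ≤ θ^{(1−β′)|b|}·|b|!·4e²θ^{β′}(D+1)·|W|`.
[cite: BalabanImbrieJaffe1988, (5.14.4) p.309, p.310 (Sect. 5.14)] -/
theorem abs_Tsum_slot_le_of_ineq5144_loc (hR : ∀ x y, adj x y → adj y x) (hD : ∀ x, (nbr x).card ≤ D)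
    (hnbr : ∀ x y, adj x y → y ∈ nbr x) (hθ0 : 0 < θ) (hθ1 : θ ≤ 1) (hβ : 0 ≤ β')
    (hsmall : 16 * ((D : ℝ) + 1) ^ 2 * (θ ^ (β' / 2) * Real.exp 2) ≤ 1) (t : ℝ) (γ : L → ↥B ⊕ ↥Ys)
    (h5144 : Ineq5144 (cubeSys I) (Finset L) (locAct (cube ∘ γ) (prime (g3 adj fun H' => zG blk Δ ℱ (fD (uD χ p ek B Φ c Ys V t) cube γ H'))))
      Finset.card (fun H (X : Finset I) => (X \ H.image (cube ∘ γ)).card) θ β') {b : Finset L} (hb : b.Nonempty) :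
    |Tsum ((polysOf W).image (cvsupp adj W)) (locv (cube ∘ γ))
        (wv (prime (g3 adj fun H' => zG blk Δ ℱ (fD (uD χ p ek B Φ c Ys V t) cube γ H')))) b| ≤
      (θ ^ (1 - β')) ^ b.card * b.card.factorial * (2 * (2 * Real.exp 2 * θ ^ β' * ((D : ℝ) + 1)) * W.card) :=
  abs_Tsum_vsupp_le_of_ineq5144_loc hR hD hnbr hθ0 hθ1 hβ hsmall h5144 hb

omit [Fintype L] in
/-- **the normalization `⟨Π_i fD_t γ ∅ i⟩_{1,W} ≠ 0` FROM THE LOCATED LEAF** (p. 310: *"This enables us to factor out the normalization"*;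
located twin of gen 11's `zG_fD_empty_ne_zero_of_ineq5144`, p25's KP zero-freeness at `H_β = ∅`). [cite: BalabanImbrieJaffe1988, (5.14.4) p.309, p.310 display 1] -/
theorem zG_fD_empty_ne_zero_of_ineq5144_loc (hR : ∀ x y, adj x y → adj y x) (hD : ∀ x, (nbr x).card ≤ D)
    (hnbr : ∀ x y, adj x y → y ∈ nbr x) (hθ0 : 0 < θ) (hθ1 : θ ≤ 1) (hβ : 0 ≤ β')
    (hsmall : 16 * ((D : ℝ) + 1) ^ 2 * (θ ^ (β' / 2) * Real.exp 2) ≤ 1)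
    (hΔ : ∀ x y, blk x ≠ blk y → ¬ adj (blk x) (blk y) → Δ x y = 0)
    (hΦloc : ∀ b : B, ∀ φ ψ : α → ℝ, (∀ x, blk x = cube (Sum.inl b) → φ x = ψ x) → Φ b φ = Φ b ψ)
    (hVloc : ∀ Y : Ys, ∀ φ ψ : α → ℝ, (∀ x, blk x = cube (Sum.inr Y) → φ x = ψ x) → V Y φ = V Y ψ) {t : ℝ}
    (γ : L → ↥B ⊕ ↥Ys)
    (h5144 : Ineq5144 (cubeSys I) (Finset L) (locAct (cube ∘ γ) (prime (g3 adj fun H' => zG blk Δ ℱ (fD (uD χ p ek B Φ c Ys V t) cube γ H'))))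
      Finset.card (fun H (X : Finset I) => (X \ H.image (cube ∘ γ)).card) θ β') :
    zG blk Δ ℱ (fD (uD χ p ek B Φ c Ys V t) cube γ ∅) W W ≠ 0 :=
  corner_empty_ne_zero_of_ineq5144_loc (W := W) (zr := fun H' => zG blk Δ ℱ (fD (uD χ p ek B Φ c Ys V t) cube γ H')) hR hD hnbr hθ0.le
    (kp_smallness_of_regime hθ0 hθ1 hβ hsmall)
    (isClusterFactorizing_zG blk Δ ℱ _ adj hΔ (fD_local blk γ (uD_local blk χ cube hΦloc hVloc t) ∅))
    (isSlotLocal_zG blk Δ ℱ (cube ∘ γ) _ fun H i => fD_slot _ cube γ H i) h5144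

/-- **display 2 of p. 310 with the display-3 truncations, for the slot data of `γ`, from the located leaf** (twin of gen 11's
`zG_fD_div_eq_sum_setPartitions_Tsum_of_ineq5144`): `⟨Π fD_t γ K⟩/⟨Π fD_t γ ∅⟩ = Σ_{π∈𝒫(K)} Π_{b∈π} T_γ(b)`.
[cite: BalabanImbrieJaffe1988, p.310 displays 1–3; (5.14.3)–(5.14.4) p.309] -/
theorem zG_fD_div_eq_sum_setPartitions_Tsum_of_ineq5144_loc (hR : ∀ x y, adj x y → adj y x) (hD : ∀ x, (nbr x).card ≤ D)
    (hnbr : ∀ x y, adj x y → y ∈ nbr x) (hθ0 : 0 < θ) (hθ1 : θ ≤ 1) (hβ : 0 ≤ β')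
    (hsmall : 16 * ((D : ℝ) + 1) ^ 2 * (θ ^ (β' / 2) * Real.exp 2) ≤ 1)
    (hΔ : ∀ x y, blk x ≠ blk y → ¬ adj (blk x) (blk y) → Δ x y = 0) (hcube : ∀ τ, cube τ ∈ W)
    (hΦloc : ∀ b : B, ∀ φ ψ : α → ℝ, (∀ x, blk x = cube (Sum.inl b) → φ x = ψ x) → Φ b φ = Φ b ψ)
    (hVloc : ∀ Y : Ys, ∀ φ ψ : α → ℝ, (∀ x, blk x = cube (Sum.inr Y) → φ x = ψ x) → V Y φ = V Y ψ) {t : ℝ}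
    (γ : L → ↥B ⊕ ↥Ys)
    (h5144 : Ineq5144 (cubeSys I) (Finset L) (locAct (cube ∘ γ) (prime (g3 adj fun H' => zG blk Δ ℱ (fD (uD χ p ek B Φ c Ys V t) cube γ H'))))
      Finset.card (fun H (X : Finset I) => (X \ H.image (cube ∘ γ)).card) θ β') (K : Finset L) :
    zG blk Δ ℱ (fD (uD χ p ek B Φ c Ys V t) cube γ K) W W / zG blk Δ ℱ (fD (uD χ p ek B Φ c Ys V t) cube γ ∅) W W =
      ∑ π ∈ setPartitions K, ∏ b ∈ π, Tsum ((polysOf W).image (cvsupp adj W)) (locv (cube ∘ γ))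
        (wv (prime (g3 adj fun H => zG blk Δ ℱ (fD (uD χ p ek B Φ c Ys V t) cube γ H)))) b :=
  zG_fD_div_eq_sum_setPartitions_Tsum blk Δ ℱ W adj χ cube hΔ hcube hΦloc hVloc γ
    (zG_fD_empty_ne_zero_of_ineq5144_loc blk Δ ℱ W adj χ cube hR hD hnbr hθ0 hθ1 hβ hsmall hΔ hΦloc hVloc γ h5144) fun b _ hb =>
    summable_norm_Tord_slot_of_ineq5144_loc blk Δ ℱ W adj χ cube hR hD hnbr hθ0 hθ1 hβ hsmall t γ h5144 b hb

/-- **`Σ_{γ ∈ asg s₀ K} T_γ(K) = (d/dt)^{|K|} log z_t` IN THE MODEL, FROM THE LOCATED LEAF** (twin of gen 11's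
`sum_asg_Tsum_eq_iteratedDeriv_log_zG_of_ineq5144`; branch `t ∈ s ⊆ (0, e^{−1}/e_k)`, nonempty `K ⊆ H`).
[cite: BalabanImbrieJaffe1988, (5.14.2) p.308; (5.14.3)–(5.14.4) p.309; p.310 displays 1–3] -/
theorem sum_asg_Tsum_eq_iteratedDeriv_log_zG_of_ineq5144_loc (hR : ∀ x y, adj x y → adj y x) (hD : ∀ x, (nbr x).card ≤ D)
    (hnbr : ∀ x y, adj x y → y ∈ nbr x) (hθ0 : 0 < θ) (hθ1 : θ ≤ 1) (hβ : 0 ≤ β')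
    (hsmall : 16 * ((D : ℝ) + 1) ^ 2 * (θ ^ (β' / 2) * Real.exp 2) ≤ 1) (hχ : ∀ x, 0 ≤ χ.χ₁ x) (hp : 0 ≤ p)
    (hΔ : ∀ x y, blk x ≠ blk y → ¬ adj (blk x) (blk y) → Δ x y = 0) (hPD : (prec blk Δ W (corner ℝ W)).PosDef)
    (hcube : ∀ τ, cube τ ∈ W)
    (hΦloc : ∀ b : B, ∀ φ ψ : α → ℝ, (∀ x, blk x = cube (Sum.inl b) → φ x = ψ x) → Φ b φ = Φ b ψ)
    (hVloc : ∀ Y : Ys, ∀ φ ψ : α → ℝ, (∀ x, blk x = cube (Sum.inr Y) → φ x = ψ x) → V Y φ = V Y ψ)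
    (hΦc : ∀ b ∈ B, Continuous (Φ b)) (hΦ0 : ∀ b ∈ B, Φ b 0 = 0) {c₀ : ℝ} (hc₀ : 0 < c₀) (hcb : ∀ b ∈ B, c₀ ≤ c b)
    (hV : ∀ Y ∈ Ys, Measurable (V Y)) {KY : υ → ℝ} (hK : ∀ Y ∈ Ys, ∀ φ, |V Y φ| ≤ KY Y) (hek : 0 < ek) {s : Set ℝ}
    (hs : UniqueDiffOn ℝ s) (hsub : s ⊆ Set.Ioo 0 (Real.exp (-1) / ek)) (s₀ : ↥B ⊕ ↥Ys) (γ₀ : L → ↥B ⊕ ↥Ys) {H : Finset L} {t : ℝ}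
    (ht : t ∈ s)
    (h5144 : ∀ γ : L → ↥B ⊕ ↥Ys, Ineq5144 (cubeSys I) (Finset L)
      (locAct (cube ∘ γ) (prime (g3 adj fun H' => zG blk Δ ℱ (fD (uD χ p ek B Φ c Ys V t) cube γ H'))))
      Finset.card (fun H (X : Finset I) => (X \ H.image (cube ∘ γ)).card) θ β') :
    ∀ K ⊆ H, K.Nonempty →
      ∑ γ ∈ asg s₀ K, Tsum ((polysOf W).image (cvsupp adj W)) (locv (cube ∘ γ))
          (wv (prime (g3 adj fun H' => zG blk Δ ℱ (fD (uD χ p ek B Φ c Ys V t) cube γ H')))) K =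
        iteratedDeriv K.card (fun x => Real.log (zG blk Δ ℱ (fD (uD χ p ek B Φ c Ys V x) cube γ₀ ∅) W W)) t :=
  sum_asg_Tsum_eq_iteratedDeriv_log_zG blk Δ ℱ W adj χ cube hχ hp hΔ hPD hcube hΦloc hVloc hΦc hΦ0 hc₀ hcb hV hK hek hs hsub s₀ γ₀ ht
    fun γ b _ hb => summable_norm_Tord_slot_of_ineq5144_loc blk Δ ℱ W adj χ cube hR hD hnbr hθ0 hθ1 hβ hsmall t γ (h5144 γ) b hb

/-- **all labels, from the located leaf: `Σ_{γ : H → slots} T_γ(H) = (d/dt)ⁿ log z_t`** (`n = |H| ≥ 1`; twin of gen 11's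
`sum_Tsum_univ_eq_iteratedDeriv_log_zG_of_ineq5144`). [cite: BalabanImbrieJaffe1988, (5.14.2) p.308; (5.14.4) p.309; p.310 displays 1–3] -/
theorem sum_Tsum_univ_eq_iteratedDeriv_log_zG_of_ineq5144_loc (hR : ∀ x y, adj x y → adj y x) (hD : ∀ x, (nbr x).card ≤ D)
    (hnbr : ∀ x y, adj x y → y ∈ nbr x) (hθ0 : 0 < θ) (hθ1 : θ ≤ 1) (hβ : 0 ≤ β')
    (hsmall : 16 * ((D : ℝ) + 1) ^ 2 * (θ ^ (β' / 2) * Real.exp 2) ≤ 1) (hχ : ∀ x, 0 ≤ χ.χ₁ x) (hp : 0 ≤ p)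
    (hΔ : ∀ x y, blk x ≠ blk y → ¬ adj (blk x) (blk y) → Δ x y = 0) (hPD : (prec blk Δ W (corner ℝ W)).PosDef)
    (hcube : ∀ τ, cube τ ∈ W)
    (hΦloc : ∀ b : B, ∀ φ ψ : α → ℝ, (∀ x, blk x = cube (Sum.inl b) → φ x = ψ x) → Φ b φ = Φ b ψ)
    (hVloc : ∀ Y : Ys, ∀ φ ψ : α → ℝ, (∀ x, blk x = cube (Sum.inr Y) → φ x = ψ x) → V Y φ = V Y ψ)
    (hΦc : ∀ b ∈ B, Continuous (Φ b)) (hΦ0 : ∀ b ∈ B, Φ b 0 = 0) {c₀ : ℝ} (hc₀ : 0 < c₀) (hcb : ∀ b ∈ B, c₀ ≤ c b)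
    (hV : ∀ Y ∈ Ys, Measurable (V Y)) {KY : υ → ℝ} (hK : ∀ Y ∈ Ys, ∀ φ, |V Y φ| ≤ KY Y) (hek : 0 < ek) {s : Set ℝ}
    (hs : UniqueDiffOn ℝ s) (hsub : s ⊆ Set.Ioo 0 (Real.exp (-1) / ek)) [Nonempty L] (γ₀ : L → ↥B ⊕ ↥Ys) {t : ℝ} (ht : t ∈ s)
    (h5144 : ∀ γ : L → ↥B ⊕ ↥Ys, Ineq5144 (cubeSys I) (Finset L)
      (locAct (cube ∘ γ) (prime (g3 adj fun H' => zG blk Δ ℱ (fD (uD χ p ek B Φ c Ys V t) cube γ H'))))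
      Finset.card (fun H (X : Finset I) => (X \ H.image (cube ∘ γ)).card) θ β') :
    ∑ γ : L → ↥B ⊕ ↥Ys, Tsum ((polysOf W).image (cvsupp adj W)) (locv (cube ∘ γ))
        (wv (prime (g3 adj fun H' => zG blk Δ ℱ (fD (uD χ p ek B Φ c Ys V t) cube γ H')))) univ =
      iteratedDeriv (Fintype.card L) (fun x => Real.log (zG blk Δ ℱ (fD (uD χ p ek B Φ c Ys V x) cube γ₀ ∅) W W)) t :=
  sum_Tsum_univ_eq_iteratedDeriv_log_zG blk Δ ℱ W adj χ cube hχ hp hΔ hPD hcube hΦloc hVloc hΦc hΦ0 hc₀ hcb hV hK hek hs hsub γ₀ ht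
    fun γ b hb => summable_norm_Tord_slot_of_ineq5144_loc blk Δ ℱ W adj χ cube hR hD hnbr hθ0 hθ1 hβ hsmall t γ (h5144 γ) b hb

/-- **the derivatives of `log z_t` are bounded, from the located leaf** (twin of gen 11's `abs_iteratedDeriv_log_zG_le_of_ineq5144`):
`|(d/dt)^{|K|} log z_t| ≤ #(asg s₀ K)·θ^{(1−β′)|K|}·|K|!·4e²θ^{β′}(D+1)·|W|`. [cite: BalabanImbrieJaffe1988, (5.14.2) p.308; (5.14.4) p.309; p.310] -/
theorem abs_iteratedDeriv_log_zG_le_of_ineq5144_loc (hR : ∀ x y, adj x y → adj y x) (hD : ∀ x, (nbr x).card ≤ D)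
    (hnbr : ∀ x y, adj x y → y ∈ nbr x) (hθ0 : 0 < θ) (hθ1 : θ ≤ 1) (hβ : 0 ≤ β')
    (hsmall : 16 * ((D : ℝ) + 1) ^ 2 * (θ ^ (β' / 2) * Real.exp 2) ≤ 1) (hχ : ∀ x, 0 ≤ χ.χ₁ x) (hp : 0 ≤ p)
    (hΔ : ∀ x y, blk x ≠ blk y → ¬ adj (blk x) (blk y) → Δ x y = 0) (hPD : (prec blk Δ W (corner ℝ W)).PosDef)
    (hcube : ∀ τ, cube τ ∈ W)
    (hΦloc : ∀ b : B, ∀ φ ψ : α → ℝ, (∀ x, blk x = cube (Sum.inl b) → φ x = ψ x) → Φ b φ = Φ b ψ)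
    (hVloc : ∀ Y : Ys, ∀ φ ψ : α → ℝ, (∀ x, blk x = cube (Sum.inr Y) → φ x = ψ x) → V Y φ = V Y ψ)
    (hΦc : ∀ b ∈ B, Continuous (Φ b)) (hΦ0 : ∀ b ∈ B, Φ b 0 = 0) {c₀ : ℝ} (hc₀ : 0 < c₀) (hcb : ∀ b ∈ B, c₀ ≤ c b)
    (hV : ∀ Y ∈ Ys, Measurable (V Y)) {KY : υ → ℝ} (hK : ∀ Y ∈ Ys, ∀ φ, |V Y φ| ≤ KY Y) (hek : 0 < ek) {s : Set ℝ}
    (hs : UniqueDiffOn ℝ s) (hsub : s ⊆ Set.Ioo 0 (Real.exp (-1) / ek)) (s₀ : ↥B ⊕ ↥Ys) (γ₀ : L → ↥B ⊕ ↥Ys) {H : Finset L} {t : ℝ}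
    (ht : t ∈ s)
    (h5144 : ∀ γ : L → ↥B ⊕ ↥Ys, Ineq5144 (cubeSys I) (Finset L)
      (locAct (cube ∘ γ) (prime (g3 adj fun H' => zG blk Δ ℱ (fD (uD χ p ek B Φ c Ys V t) cube γ H'))))
      Finset.card (fun H (X : Finset I) => (X \ H.image (cube ∘ γ)).card) θ β') {K : Finset L} (hKH : K ⊆ H) (hKne : K.Nonempty) :
    |iteratedDeriv K.card (fun x => Real.log (zG blk Δ ℱ (fD (uD χ p ek B Φ c Ys V x) cube γ₀ ∅) W W)) t| ≤
      (asg s₀ K : Finset (L → ↥B ⊕ ↥Ys)).card *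
        ((θ ^ (1 - β')) ^ K.card * K.card.factorial * (2 * (2 * Real.exp 2 * θ ^ β' * ((D : ℝ) + 1)) * W.card)) := by
  rw [← sum_asg_Tsum_eq_iteratedDeriv_log_zG_of_ineq5144_loc blk Δ ℱ W adj χ cube hR hD hnbr hθ0 hθ1 hβ hsmall hχ hp hΔ hPD hcube hΦloc hVloc
    hΦc hΦ0 hc₀ hcb hV hK hek hs hsub s₀ γ₀ ht h5144 K hKH hKne]
  refine (abs_sum_le_sum_abs _ _).trans ?_
  calc ∑ γ ∈ asg s₀ K, |Tsum ((polysOf W).image (cvsupp adj W)) (locv (cube ∘ γ))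
          (wv (prime (g3 adj fun H' => zG blk Δ ℱ (fD (uD χ p ek B Φ c Ys V t) cube γ H')))) K|
      ≤ ∑ γ ∈ asg s₀ K, (θ ^ (1 - β')) ^ K.card * K.card.factorial * (2 * (2 * Real.exp 2 * θ ^ β' * ((D : ℝ) + 1)) * W.card) :=
        sum_le_sum fun γ _ => abs_Tsum_slot_le_of_ineq5144_loc blk Δ ℱ W adj χ cube hR hD hnbr hθ0 hθ1 hβ hsmall t γ (h5144 γ) hKne
    _ = _ := by rw [sum_const, nsmul_eq_mul]

/-- **(5.14.2) IN THE MODEL WITH THE TRUNCATED FUNCTIONS OF DISPLAY 3, FROM THE LOCATED LEAF** (twin of gen 11's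
`remR_sum_Tsum_eq_integral_log_zG_of_ineq5144`): `remR(t ↦ Σ_γ T_{γ,t}(L)) n̄ = −(1/(n̄+1)) ∫₀¹ ((1−t)^{n̄}/n̄!)(d/dt)^{n̄+1} log z_t dt`.
[cite: BalabanImbrieJaffe1988, (5.14.2) p.308; (5.14.3)–(5.14.4) p.309; p.310 displays 1–3] -/
theorem remR_sum_Tsum_eq_integral_log_zG_of_ineq5144_loc (hR : ∀ x y, adj x y → adj y x) (hD : ∀ x, (nbr x).card ≤ D)
    (hnbr : ∀ x y, adj x y → y ∈ nbr x) (hθ0 : 0 < θ) (hθ1 : θ ≤ 1) (hβ : 0 ≤ β')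
    (hsmall : 16 * ((D : ℝ) + 1) ^ 2 * (θ ^ (β' / 2) * Real.exp 2) ≤ 1) (hχ : ∀ x, 0 ≤ χ.χ₁ x) (hp : 0 ≤ p)
    (hΔ : ∀ x y, blk x ≠ blk y → ¬ adj (blk x) (blk y) → Δ x y = 0) (hPD : (prec blk Δ W (corner ℝ W)).PosDef)
    (hcube : ∀ τ, cube τ ∈ W)
    (hΦloc : ∀ b : B, ∀ φ ψ : α → ℝ, (∀ x, blk x = cube (Sum.inl b) → φ x = ψ x) → Φ b φ = Φ b ψ)
    (hVloc : ∀ Y : Ys, ∀ φ ψ : α → ℝ, (∀ x, blk x = cube (Sum.inr Y) → φ x = ψ x) → V Y φ = V Y ψ)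
    (hΦc : ∀ b ∈ B, Continuous (Φ b)) (hΦ0 : ∀ b ∈ B, Φ b 0 = 0) {c₀ : ℝ} (hc₀ : 0 < c₀) (hcb : ∀ b ∈ B, c₀ ≤ c b)
    (hV : ∀ Y ∈ Ys, Measurable (V Y)) {KY : υ → ℝ} (hK : ∀ Y ∈ Ys, ∀ φ, |V Y φ| ≤ KY Y) (hek : 0 < ek)
    (hek1 : ek < Real.exp (-1)) {nbar : ℕ} (hL : Fintype.card L = nbar + 1) (γ₀ : L → ↥B ⊕ ↥Ys)
    (h5144 : ∀ t ∈ Set.Ioc (0 : ℝ) 1, ∀ γ : L → ↥B ⊕ ↥Ys, Ineq5144 (cubeSys I) (Finset L)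
      (locAct (cube ∘ γ) (prime (g3 adj fun H' => zG blk Δ ℱ (fD (uD χ p ek B Φ c Ys V t) cube γ H'))))
      Finset.card (fun H (X : Finset I) => (X \ H.image (cube ∘ γ)).card) θ β') :
    remR (fun t => ∑ γ : L → ↥B ⊕ ↥Ys, Tsum ((polysOf W).image (cvsupp adj W)) (locv (cube ∘ γ))
        (wv (prime (g3 adj fun H' => zG blk Δ ℱ (fD (uD χ p ek B Φ c Ys V t) cube γ H')))) univ) nbar =
      -(1 / (nbar + 1 : ℝ)) * ∫ t in (0 : ℝ)..1, ((1 - t) ^ nbar / nbar.factorial) *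
        iteratedDerivWithin (nbar + 1) (fun x => Real.log (zG blk Δ ℱ (fD (uD χ p ek B Φ c Ys V x) cube γ₀ ∅) W W))
          (Set.uIcc 0 1) t :=
  remR_sum_Tsum_eq_integral_log_zG blk Δ ℱ W adj χ cube hχ hp hΔ hPD hcube hΦloc hVloc hΦc hΦ0 hc₀ hcb hV hK hek hek1 hL γ₀
    fun t ht γ b hb => summable_norm_Tord_slot_of_ineq5144_loc blk Δ ℱ W adj χ cube hR hD hnbr hθ0 hθ1 hβ hsmall t γ (h5144 t ht γ) b hb

/-- **THE (5.14.2) REMAINDER IS `O(|W|)`, FROM THE LOCATED LEAF** (twin of gen 11's `abs_remR_sum_Tsum_le_of_ineq5144`):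
`|remR(t ↦ Σ_γ T_{γ,t}(L)) n̄| ≤ N_s^{n̄+1}·θ^{(1−β′)(n̄+1)}·4e²θ^{β′}(D+1)·|W|`. [cite: BalabanImbrieJaffe1988, (5.14.2) p.308; (5.14.4) p.309; p.310] -/
theorem abs_remR_sum_Tsum_le_of_ineq5144_loc (hR : ∀ x y, adj x y → adj y x) (hD : ∀ x, (nbr x).card ≤ D)
    (hnbr : ∀ x y, adj x y → y ∈ nbr x) (hθ0 : 0 < θ) (hθ1 : θ ≤ 1) (hβ : 0 ≤ β')
    (hsmall : 16 * ((D : ℝ) + 1) ^ 2 * (θ ^ (β' / 2) * Real.exp 2) ≤ 1) {nbar : ℕ} (hL : Fintype.card L = nbar + 1)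
    (h5144 : ∀ t ∈ Set.Ioc (0 : ℝ) 1, ∀ γ : L → ↥B ⊕ ↥Ys, Ineq5144 (cubeSys I) (Finset L)
      (locAct (cube ∘ γ) (prime (g3 adj fun H' => zG blk Δ ℱ (fD (uD χ p ek B Φ c Ys V t) cube γ H'))))
      Finset.card (fun H (X : Finset I) => (X \ H.image (cube ∘ γ)).card) θ β') :
    |remR (fun t => ∑ γ : L → ↥B ⊕ ↥Ys, Tsum ((polysOf W).image (cvsupp adj W)) (locv (cube ∘ γ))
        (wv (prime (g3 adj fun H' => zG blk Δ ℱ (fD (uD χ p ek B Φ c Ys V t) cube γ H')))) univ) nbar| ≤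
      (Fintype.card (L → ↥B ⊕ ↥Ys) : ℝ) * ((θ ^ (1 - β')) ^ (nbar + 1) * (2 * (2 * Real.exp 2 * θ ^ β' * ((D : ℝ) + 1)) * W.card)) := by
  haveI : Nonempty L := Fintype.card_pos_iff.1 (by omega)
  set Kc : ℝ := 2 * (2 * Real.exp 2 * θ ^ β' * ((D : ℝ) + 1)) * W.card with hKc
  set Ns : ℝ := (Fintype.card (L → ↥B ⊕ ↥Ys) : ℝ) with hNs
  have hKc0 : 0 ≤ Kc := by rw [hKc]; positivity
  have hθ' : 0 ≤ (θ ^ (1 - β')) ^ (nbar + 1) := pow_nonneg (Real.rpow_nonneg hθ0.le _) _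
  -- the uniform bound on the assignment-summed truncated function on `(0,1]`
  have hbound : ∀ t ∈ Set.Ioc (0 : ℝ) 1,
      |∑ γ : L → ↥B ⊕ ↥Ys, Tsum ((polysOf W).image (cvsupp adj W)) (locv (cube ∘ γ))
          (wv (prime (g3 adj fun H' => zG blk Δ ℱ (fD (uD χ p ek B Φ c Ys V t) cube γ H')))) univ| ≤
        Ns * ((θ ^ (1 - β')) ^ (nbar + 1) * (nbar + 1).factorial * Kc) := by
    intro t ht
    refine (abs_sum_le_sum_abs _ _).trans ?_
    calc ∑ γ : L → ↥B ⊕ ↥Ys, |Tsum ((polysOf W).image (cvsupp adj W)) (locv (cube ∘ γ))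
            (wv (prime (g3 adj fun H' => zG blk Δ ℱ (fD (uD χ p ek B Φ c Ys V t) cube γ H')))) univ|
        ≤ ∑ _γ : L → ↥B ⊕ ↥Ys, (θ ^ (1 - β')) ^ (nbar + 1) * (nbar + 1).factorial * Kc :=
          sum_le_sum fun γ _ => by
            have h := abs_Tsum_slot_le_of_ineq5144_loc blk Δ ℱ W adj χ cube hR hD hnbr hθ0 hθ1 hβ hsmall t γ (h5144 t ht γ)
              (univ_nonempty (α := L))
            rwa [card_univ, hL] at h
      _ = Ns * ((θ ^ (1 - β')) ^ (nbar + 1) * (nbar + 1).factorial * Kc) := by rw [sum_const, card_univ, nsmul_eq_mul]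
  -- the `t`-integral against the printed weight `(1−t)^{n̄}/(n̄+1)!`
  have hw1 : ∀ x ∈ Set.Ioc (0 : ℝ) 1, |(1 - x) ^ nbar / ((nbar + 1).factorial : ℝ)| ≤ 1 / (nbar + 1).factorial := by
    intro x hx
    rw [abs_div, Nat.abs_cast, abs_pow]
    refine div_le_div_of_nonneg_right ?_ (by positivity)
    exact pow_le_one₀ (abs_nonneg _) (by rw [abs_le]; constructor <;> linarith [hx.1, hx.2])
  have key : ∀ x ∈ Set.uIoc (0 : ℝ) 1,
      ‖-((1 - x) ^ nbar / ((nbar + 1).factorial : ℝ)) * ∑ γ : L → ↥B ⊕ ↥Ys, Tsum ((polysOf W).image (cvsupp adj W)) (locv (cube ∘ γ))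
          (wv (prime (g3 adj fun H' => zG blk Δ ℱ (fD (uD χ p ek B Φ c Ys V x) cube γ H')))) univ‖ ≤
        1 / (nbar + 1).factorial * (Ns * ((θ ^ (1 - β')) ^ (nbar + 1) * (nbar + 1).factorial * Kc)) := by
    intro x hx
    rw [Set.uIoc_of_le zero_le_one] at hx
    rw [norm_mul, Real.norm_eq_abs, Real.norm_eq_abs, abs_neg]
    exact mul_le_mul (hw1 x hx) (hbound x hx) (abs_nonneg _) (by positivity)
  have hint := intervalIntegral.norm_integral_le_of_norm_le_const key
  rw [Real.norm_eq_abs, sub_zero, abs_one, mul_one] at hint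
  unfold remR
  refine hint.trans (le_of_eq ?_)
  have hf : ((nbar + 1).factorial : ℝ) ≠ 0 := by positivity
  field_simp

/-- **THE CUMULANTS ARE THE CONNECTED-GRAPH SERIES OF DISPLAY 3, FROM THE LOCATED LEAF** (twin of gen 11's
`BIJ88SlotCumulants308.ursell_slotMoment_fieldLaw_eq_Tsum_of_ineq5144`; p. 310: *"Thus we have a formula ⟨Π_{j∈H}[;(d/dt)_{γ_j}]⟩_t = Σ … Σ_{G_c} …"*).
[cite: BalabanImbrieJaffe1988, p.310 displays 2–3; (5.14.4) p.309] -/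
theorem ursell_slotMoment_fieldLaw_eq_Tsum_of_ineq5144_loc (hR : ∀ x y, adj x y → adj y x) (hD : ∀ x, (nbr x).card ≤ D)
    (hnbr : ∀ x y, adj x y → y ∈ nbr x) (hθ0 : 0 < θ) (hθ1 : θ ≤ 1) (hβ : 0 ≤ β')
    (hsmall : 16 * ((D : ℝ) + 1) ^ 2 * (θ ^ (β' / 2) * Real.exp 2) ≤ 1)
    (hΔ : ∀ x y, blk x ≠ blk y → ¬ adj (blk x) (blk y) → Δ x y = 0) (hcube : ∀ τ, cube τ ∈ W)
    (hΦloc : ∀ b : B, ∀ φ ψ : α → ℝ, (∀ x, blk x = cube (Sum.inl b) → φ x = ψ x) → Φ b φ = Φ b ψ)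
    (hVloc : ∀ Y : Ys, ∀ φ ψ : α → ℝ, (∀ x, blk x = cube (Sum.inr Y) → φ x = ψ x) → V Y φ = V Y ψ) {t : ℝ}
    (γ : L → ↥B ⊕ ↥Ys)
    (h5144 : Ineq5144 (cubeSys I) (Finset L) (locAct (cube ∘ γ) (prime (g3 adj fun H' => zG blk Δ ℱ (fD (uD χ p ek B Φ c Ys V t) cube γ H'))))
      Finset.card (fun H (X : Finset I) => (X \ H.image (cube ∘ γ)).card) θ β') {K : Finset L} (hKne : K.Nonempty) :
    ursellOf (fun K' => slotMoment χ p ek B (fun b ω => Φ b (ext blk W ω)) c Ys (fun Y ω => V Y (ext blk W ω))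
        (fieldLaw blk Δ ℱ W) t K' γ) K =
      Tsum ((polysOf W).image (cvsupp adj W)) (locv (cube ∘ γ))
        (wv (prime (g3 adj fun H' => zG blk Δ ℱ (fD (uD χ p ek B Φ c Ys V t) cube γ H')))) K :=
  trunc_eq_Tsum_of_display2 blk Δ ℱ W adj χ cube hΔ hcube hΦloc hVloc γ
    (zG_fD_empty_ne_zero_of_ineq5144_loc blk Δ ℱ W adj χ cube hR hD hnbr hθ0 hθ1 hβ hsmall hΔ hΦloc hVloc γ h5144) (H := K)
    (fun b _ hb => summable_norm_Tord_slot_of_ineq5144_loc blk Δ ℱ W adj χ cube hR hD hnbr hθ0 hθ1 hβ hsmall t γ h5144 b hb)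
    (fun A => ursellOf (fun K' => slotMoment χ p ek B (fun b ω => Φ b (ext blk W ω)) c Ys (fun Y ω => V Y (ext blk W ω))
      (fieldLaw blk Δ ℱ W) t K' γ) A)
    (fun _ _ hK' => slotMoment_eq_sum_setPartitions_ursell χ _ t γ hK') K Subset.rfl hKne

/-- **(5.14.1)–(5.14.2) AT `t = 0` WITH THE REMAINDER AS THE DISPLAY-3 SERIES, LINEAR-OR-MODULUS SLOT FIELDS, NO CENTRING, FROM THE LOCATED
LEAF** (twin of gen 12's `BIJ88GaussShellModulus309.effectiveAction_fieldLaw_eq_pertP_add_remR_Tsum_of_ineq5144_mod`; explicit arguments in the order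
`blk Δ ℱ W adj χ cube`). [cite: BalabanImbrieJaffe1988, (5.14.1)–(5.14.2) p.308; p.310 display 3; (5.14.4) p.309] -/
theorem effectiveAction_fieldLaw_eq_pertP_add_remR_Tsum_of_ineq5144_mod_loc (hR : ∀ x y, adj x y → adj y x) (hD : ∀ x, (nbr x).card ≤ D)
    (hnbr : ∀ x y, adj x y → y ∈ nbr x) (hθ0 : 0 < θ) (hθ1 : θ ≤ 1) (hβ : 0 ≤ β')
    (hsmall : 16 * ((D : ℝ) + 1) ^ 2 * (θ ^ (β' / 2) * Real.exp 2) ≤ 1) (hχ : ∀ x, 0 ≤ χ.χ₁ x) (hp : 1 / 2 < p)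
    (hΔ : ∀ x y, blk x ≠ blk y → ¬ adj (blk x) (blk y) → Δ x y = 0) (hPD : (prec blk Δ W (corner ℝ W)).PosDef)
    (hcube : ∀ τ, cube τ ∈ W)
    (hΦloc : ∀ b : B, ∀ φ ψ : α → ℝ, (∀ x, blk x = cube (Sum.inl b) → φ x = ψ x) → Φ b φ = Φ b ψ)
    (hVloc : ∀ Y : Ys, ∀ φ ψ : α → ℝ, (∀ x, blk x = cube (Sum.inr Y) → φ x = ψ x) → V Y φ = V Y ψ)
    (hmod : ∀ b ∈ B, ∃ ℓ₁ ℓ₂ : (α → ℝ) → ℝ, IsLinearMap ℝ ℓ₁ ∧ IsLinearMap ℝ ℓ₂ ∧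
      ((∀ φ, Φ b φ = ℓ₁ φ) ∨ (∀ φ, Φ b φ = Real.sqrt (ℓ₁ φ ^ 2 + ℓ₂ φ ^ 2))))
    {c₀ : ℝ} (hc₀ : 0 < c₀) (hcb : ∀ b ∈ B, c₀ ≤ c b) (hV : ∀ Y ∈ Ys, Measurable (V Y))
    {KY : υ → ℝ} (hK : ∀ Y ∈ Ys, ∀ φ, |V Y φ| ≤ KY Y) (hek : 0 < ek) (hek1 : ek < Real.exp (-1)) {nbar : ℕ}
    (hL : Fintype.card L = nbar + 1) (s₀ : ↥B ⊕ ↥Ys) (γ₀ : L → ↥B ⊕ ↥Ys)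
    (h5144 : ∀ t ∈ Set.Ioc (0 : ℝ) 1, ∀ γ : L → ↥B ⊕ ↥Ys, Ineq5144 (cubeSys I) (Finset L)
      (locAct (cube ∘ γ) (prime (g3 adj fun H' => zG blk Δ ℱ (fD (uD χ p ek B Φ c Ys V t) cube γ H'))))
      Finset.card (fun H (X : Finset I) => (X \ H.image (cube ∘ γ)).card) θ β') :
    -Real.log (zG blk Δ ℱ (fD (uD χ p ek B Φ c Ys V 1) cube γ₀ ∅) W W) =
        pertP (fun t => Real.log (zG blk Δ ℱ (fD (uD χ p ek B Φ c Ys V t) cube γ₀ ∅) W W)) nbar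
          + (nbar + 1 : ℝ) * remR (fun t => ∑ γ : L → ↥B ⊕ ↥Ys, Tsum ((polysOf W).image (cvsupp adj W)) (locv (cube ∘ γ))
              (wv (prime (g3 adj fun H' => zG blk Δ ℱ (fD (uD χ p ek B Φ c Ys V t) cube γ H')))) univ) nbar ∧
      -Real.log (zG blk Δ ℱ (fD (uD χ p ek B Φ c Ys V 1) cube γ₀ ∅) W W) =
        pertP (fun t => Real.log (zG blk Δ ℱ (fD (uD χ p ek B Φ c Ys V t) cube γ₀ ∅) W W)) nbar
          + ∫ t in (0 : ℝ)..1, -((1 - t) ^ nbar / nbar.factorial) *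
              ∑ γ : L → ↥B ⊕ ↥Ys, Tsum ((polysOf W).image (cvsupp adj W)) (locv (cube ∘ γ))
                (wv (prime (g3 adj fun H' => zG blk Δ ℱ (fD (uD χ p ek B Φ c Ys V t) cube γ H')))) univ := by
  haveI : Nonempty L := Fintype.card_pos_iff.1 (by omega)
  obtain ⟨hA, -⟩ :=
    effectiveAction_fieldLaw_eq_pertP_add_remR_ursell_mod blk Δ ℱ W χ cube hχ hp hPD hcube hmod hc₀ hcb hV hK hek hek1 hL s₀ γ₀
  have hTs : ∀ t ∈ Set.Ioc (0 : ℝ) 1,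
      ∑ γ : L → ↥B ⊕ ↥Ys, ursellOf (fun K' => slotMoment χ p ek B (fun b ω => Φ b (ext blk W ω)) c Ys
          (fun Y ω => V Y (ext blk W ω)) (fieldLaw blk Δ ℱ W) t K' γ) univ =
        ∑ γ : L → ↥B ⊕ ↥Ys, Tsum ((polysOf W).image (cvsupp adj W)) (locv (cube ∘ γ))
          (wv (prime (g3 adj fun H' => zG blk Δ ℱ (fD (uD χ p ek B Φ c Ys V t) cube γ H')))) univ := fun t ht =>
    Finset.sum_congr rfl fun γ _ =>
      ursell_slotMoment_fieldLaw_eq_Tsum_of_ineq5144_loc blk Δ ℱ W adj χ cube hR hD hnbr hθ0 hθ1 hβ hsmall hΔ hcube hΦloc hVloc γ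
        (h5144 t ht γ) Finset.univ_nonempty
  have hA' := (remR_congr_Ioc hTs nbar) ▸ hA
  exact ⟨hA', by rw [← succ_mul_remR]; exact hA'⟩

/-- **`|−log z₁ − 𝒫̃_{k+1}| ≤ (n̄+1)·N_s^{n̄+1}·θ^{(1−β′)(n̄+1)}·4e²θ^{β′}(D+1)·|W|`, FROM THE LOCATED LEAF** (twin of gen 12's
`abs_effectiveAction_sub_pertP_le_of_ineq5144_mod`). [cite: BalabanImbrieJaffe1988, (5.14.2) p.308; p.310 (Sect. 5.14); (5.14.4) p.309] -/
theorem abs_effectiveAction_sub_pertP_le_of_ineq5144_mod_loc (hR : ∀ x y, adj x y → adj y x) (hD : ∀ x, (nbr x).card ≤ D)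
    (hnbr : ∀ x y, adj x y → y ∈ nbr x) (hθ0 : 0 < θ) (hθ1 : θ ≤ 1) (hβ : 0 ≤ β')
    (hsmall : 16 * ((D : ℝ) + 1) ^ 2 * (θ ^ (β' / 2) * Real.exp 2) ≤ 1) (hχ : ∀ x, 0 ≤ χ.χ₁ x) (hp : 1 / 2 < p)
    (hΔ : ∀ x y, blk x ≠ blk y → ¬ adj (blk x) (blk y) → Δ x y = 0) (hPD : (prec blk Δ W (corner ℝ W)).PosDef)
    (hcube : ∀ τ, cube τ ∈ W)
    (hΦloc : ∀ b : B, ∀ φ ψ : α → ℝ, (∀ x, blk x = cube (Sum.inl b) → φ x = ψ x) → Φ b φ = Φ b ψ)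
    (hVloc : ∀ Y : Ys, ∀ φ ψ : α → ℝ, (∀ x, blk x = cube (Sum.inr Y) → φ x = ψ x) → V Y φ = V Y ψ)
    (hmod : ∀ b ∈ B, ∃ ℓ₁ ℓ₂ : (α → ℝ) → ℝ, IsLinearMap ℝ ℓ₁ ∧ IsLinearMap ℝ ℓ₂ ∧
      ((∀ φ, Φ b φ = ℓ₁ φ) ∨ (∀ φ, Φ b φ = Real.sqrt (ℓ₁ φ ^ 2 + ℓ₂ φ ^ 2))))
    {c₀ : ℝ} (hc₀ : 0 < c₀) (hcb : ∀ b ∈ B, c₀ ≤ c b) (hV : ∀ Y ∈ Ys, Measurable (V Y))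
    {KY : υ → ℝ} (hK : ∀ Y ∈ Ys, ∀ φ, |V Y φ| ≤ KY Y) (hek : 0 < ek) (hek1 : ek < Real.exp (-1)) {nbar : ℕ}
    (hL : Fintype.card L = nbar + 1) (s₀ : ↥B ⊕ ↥Ys) (γ₀ : L → ↥B ⊕ ↥Ys)
    (h5144 : ∀ t ∈ Set.Ioc (0 : ℝ) 1, ∀ γ : L → ↥B ⊕ ↥Ys, Ineq5144 (cubeSys I) (Finset L)
      (locAct (cube ∘ γ) (prime (g3 adj fun H' => zG blk Δ ℱ (fD (uD χ p ek B Φ c Ys V t) cube γ H'))))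
      Finset.card (fun H (X : Finset I) => (X \ H.image (cube ∘ γ)).card) θ β') :
    |-Real.log (zG blk Δ ℱ (fD (uD χ p ek B Φ c Ys V 1) cube γ₀ ∅) W W) -
        pertP (fun t => Real.log (zG blk Δ ℱ (fD (uD χ p ek B Φ c Ys V t) cube γ₀ ∅) W W)) nbar| ≤
      (nbar + 1 : ℝ) * ((Fintype.card (L → ↥B ⊕ ↥Ys) : ℝ) *
        ((θ ^ (1 - β')) ^ (nbar + 1) * (2 * (2 * Real.exp 2 * θ ^ β' * ((D : ℝ) + 1)) * W.card))) := by
  obtain ⟨hA, -⟩ := effectiveAction_fieldLaw_eq_pertP_add_remR_Tsum_of_ineq5144_mod_loc blk Δ ℱ W adj χ cube hR hD hnbr hθ0 hθ1 hβ hsmall hχ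
    hp hΔ hPD hcube hΦloc hVloc hmod hc₀ hcb hV hK hek hek1 hL s₀ γ₀ h5144
  have hb := abs_remR_sum_Tsum_le_of_ineq5144_loc blk Δ ℱ W adj χ cube hR hD hnbr hθ0 hθ1 hβ hsmall hL h5144
  rw [hA, add_sub_cancel_left, abs_mul, abs_of_nonneg (by positivity : (0 : ℝ) ≤ nbar + 1)]
  exact mul_le_mul_of_nonneg_left hb (by positivity)


end Model
end Literature.MathematicalPhysics.QuantumFieldTheory.BalabanImbrieJaffe1984to88.BIJ88SlotConnectedGraph310KPLoc

end
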